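import Summits.QuantumFields.QCD.Theses.SpectralDefectExtinction
import Summits.QuantumFields.QCD.Theorems.ExtinctionBuildsQCD.Negative.WithoutTightCollapse
import Summits.QuantumFields.QCD.Theorems.TipPricing.Negative.TightPins

/-!
# `TipPricing` / line `hermitian-flow-coarea`: the transferred target `HeavySideDOS` is FREE on the
free side of the Wilson hole (drefute seat, crux item stmt-QuantumFields-8967)

Negative-side bookkeeping for the hard stub `stub_lifshitzTight` of the picked line
`Cruxes/TipPricing/Lines/hermitian-flow-coarea.lean` (skeleton namespace
`Summit.QuantumFields.QCD.Cruxes.TipPricing.HermitianFlowCoarea`; provers cannot import `Lines/`, so the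
two line-local statements `HeavySideDOS`, `LifshitzTight` are restated here VERBATIM — same binder
names, same terms, the skeleton's `TightClause` spelled as the landed `Tight` (`Iff.rfl`) — and are
definitionally the skeleton's).

* `heavySideDOS_of_mcrit_nonneg` — for EVERY regularisation whose line never enters the hole
  (`m_crit(k) ≥ 0` for all `k`), every `c ≤ 1` and every positive mass tuple, BOTH clauses of
  `HeavySideDOS` hold with nothing to prove: clause (A) because its `t`-integrand vanishes identically on
  `[-1, t_f(k)]` once `η < min(m_crit(k) + a_k m_f/Z_m(k), 1)` (coercivity of the Hermitian Wilson operator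
  at positive bare mass `-t`, landed `countP_coercivityDefect_eq_zero`), clause (B) verbatim as in
  `defectCount_eq_zero`.  So the DOS transfer of the line adds NO obstruction on the free side: exactly like
  EXTINCT (`extinct_of_mcrit_nonneg`), `HeavySideDOS` is vacuous there.
* `lifshitzTight_of_freeSideTight` — consequently the hard stub is implied by "TIGHT on the free side for
  `N_f = 2, 3`" (the junk line of `Cruxes/TipPricing/Disproof.lean` §6, `TightOnFreeSide`), with BOTH crux
  hypotheses `TipNoBinding`, `WegnerEstimate` unused: the transferred target `C⁺ = HeavySideDOS ∧ TIGHT` is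
  junk-closable by volume padding precisely when the crux is (misstatement signal on item 8964 applies
  verbatim to the stub; no new content is forced by the DOS form).
* `mcrit_le_window_of_heavySideDOS_and_tight` — conversely every witness of the hard stub obeys the TIGHT pin
  `m_crit(k) ≤ a_k M/Z_m(k)` eventually for every `M > M₀` (landed `TightPins` logic, re-derived from
  `Tight`), so its line lives in `(-8, o(1)]`.
-/

noncomputable section

namespace Summit.QuantumFields.QCD.Theorems.TipPricing.Negative.HeavySideDOSFreeSide

open scoped BigOperators Topology Classical MeasureTheory Matrix ComplexConjugate
open Filter MeasureTheory
open Literature.MathematicalPhysics.QuantumLattice Literature.MathematicalPhysics.QuantumFieldTheory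
  Literature.Probability.LatticeModels
open Summit.QuantumFields.QCD.Theses.SpectralDefectExtinction
open Summit.QuantumFields.QCD.Theorems.ExtinctionBuildsQCD.Negative

/-- VERBATIM copy of the line's `HeavySideDOS` (skeleton §1). -/
def HeavySideDOS (Nf : ℕ) (reg : QCDRegularisation Nf) (c : ℝ) (m : Fin Nf → ℝ) : Prop :=
    ∀ ε : ℝ, 0 < ε → ∀ᶠ k : ℕ in Filter.atTop, ∀ S : ℕ, reg.L k ≤ S → ∀ f : Fin Nf, (∃ η₀ : ℝ, 0 <
      η₀ ∧ ∀ η : ℝ, 0 < η → η < η₀ → (∫ t in (-1 : ℝ)..(-(reg.mcrit k + reg.a k * m f / reg.Zm k)),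
      (∫ U, (Multiset.countP (fun z : ℂ => |z.re| < η) (spinorLift gammaFive * wilsonDirac
      (fundamentalRep (Fin 3)) U (-t) 1).charpoly.roots : ℝ) * ∏ f : Fin Nf, ‖fermionDet
      (wilsonDirac (fundamentalRep (Fin 3)) U (reg.mcrit k + reg.a k * m f / reg.Zm k) 1)‖
      ∂(wilsonMeasure (fundamentalRep (Fin 3)) (reg.β k) : Measure (GaugeConfig 4 (2 * S + 1)
      SU3)))) / (∫ U, ∏ f : Fin Nf, ‖fermionDet (wilsonDirac (fundamentalRep (Fin 3)) U (reg.mcrit k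
      + reg.a k * m f / reg.Zm k) 1)‖ ∂(wilsonMeasure (fundamentalRep (Fin 3)) (reg.β k) : Measure
      (GaugeConfig 4 (2 * S + 1) SU3))) ≤ 2 * η * (ε * ((2 * S + 1 : ℝ) / (2 * reg.L k + 1)) ^ 4)) ∧
      (∫ U, (Multiset.countP (fun z : ℂ => |z.re| < c * (reg.a k * m f / reg.Zm k)) (spinorLift
      gammaFive * wilsonDirac (fundamentalRep (Fin 3)) U (reg.mcrit k + reg.a k * m f / reg.Zm k)
      1).charpoly.roots : ℝ) * ∏ f : Fin Nf, ‖fermionDet (wilsonDirac (fundamentalRep (Fin 3)) U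
      (reg.mcrit k + reg.a k * m f / reg.Zm k) 1)‖ ∂(wilsonMeasure (fundamentalRep (Fin 3)) (reg.β
      k) : Measure (GaugeConfig 4 (2 * S + 1) SU3))) / (∫ U, ∏ f : Fin Nf, ‖fermionDet (wilsonDirac
      (fundamentalRep (Fin 3)) U (reg.mcrit k + reg.a k * m f / reg.Zm k) 1)‖ ∂(wilsonMeasure
      (fundamentalRep (Fin 3)) (reg.β k) : Measure (GaugeConfig 4 (2 * S + 1) SU3))) ≤ ε * ((2 * S +
      1 : ℝ) / (2 * reg.L k + 1)) ^ 4

/-- The line's hard stub statement `LifshitzTight` (skeleton §2), verbatim except that the skeleton's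
`TightClause` is written as the landed `Tight` (the skeleton certifies `TightClause ↔ Tight` by `Iff.rfl`,
`tightClause_iff`), so this `def` is definitionally the skeleton's. -/
def LifshitzTight : Prop :=
    TipNoBinding → WegnerEstimate → ∀ Nf : ℕ, (Nf = 2 ∨ Nf = 3) → ∃ reg : QCDRegularisation Nf,
      reg.HasMassScaling ∧ (reg.scheme 0 0 0).HasAsymptoticScaling ∧ ∃ M₀ : ℝ, 0 ≤ M₀ ∧ ∃ c : ℝ, 0 <
      c ∧ ∀ m : Fin Nf → ℝ, (∀ f, M₀ < m f) → HeavySideDOS Nf reg c m ∧ Tight Nf reg M₀ m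

/-- **`HeavySideDOS` is free on the free side.**  For every regularisation with `m_crit(k) ≥ 0` for all
`k`, every `c ≤ 1` and every positive mass tuple, both clauses of `HeavySideDOS` hold at EVERY step, on
EVERY torus, for EVERY flavour — clause (A) with `η₀ = min (m_crit(k) + a_k m_f/Z_m(k)) 1`, because for
`t ≤ -(m_crit(k) + a_k m_f/Z_m(k))` the Hermitian Wilson operator `Γ₅ D_W(U,-t,1)` has no eigenvalue
of modulus `< η ≤ -t` (`countP_coercivityDefect_eq_zero`), so the `t`-integrand is identically `0`;
clause (B) because the window `c a_k m_f/Z_m(k) ≤ m_crit(k) + a_k m_f/Z_m(k)` lies inside the coercivity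
gap.  No scaling, coupling, volume or measurability hypothesis is used. -/
theorem heavySideDOS_of_mcrit_nonneg {Nf : ℕ} (reg : QCDRegularisation Nf)
    (hcrit : ∀ k, 0 ≤ reg.mcrit k) {c : ℝ} (hc1 : c ≤ 1) (m : Fin Nf → ℝ) (hm : ∀ f, 0 < m f) :
    HeavySideDOS Nf reg c m := by
  intro ε hε
  refine Filter.Eventually.of_forall fun k S _ f => ?_
  have hw : 0 < reg.a k * m f / reg.Zm k := div_pos (mul_pos (reg.a_pos k) (hm f)) (reg.Zm_pos k)
  have hμ₀ : 0 < reg.mcrit k + reg.a k * m f / reg.Zm k := by have := hcrit k; linarith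
  constructor
  · refine ⟨min (reg.mcrit k + reg.a k * m f / reg.Zm k) 1, lt_min hμ₀ one_pos, fun η hη hηlt => ?_⟩
    have hη1 : η < reg.mcrit k + reg.a k * m f / reg.Zm k := lt_of_lt_of_le hηlt (min_le_left _ _)
    have hη2 : η < 1 := lt_of_lt_of_le hηlt (min_le_right _ _)
    rw [intervalIntegral.integral_congr (g := fun _ => (0 : ℝ)) ?_, intervalIntegral.integral_zero,
      zero_div]
    · positivity
    · intro t ht
      rw [Set.mem_uIcc] at ht
      have hle : η ≤ -t := by
        rcases ht with ⟨-, h2⟩ | ⟨-, h2⟩ <;> linarith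
      have h0 : ∀ U : GaugeConfig 4 (2 * S + 1) SU3, Multiset.countP (fun z : ℂ => |z.re| < η)
          (spinorLift gammaFive * wilsonDirac (fundamentalRep (Fin 3)) U (-t) 1).charpoly.roots = 0 :=
        fun U => countP_coercivityDefect_eq_zero U hle
      simp only [h0, Nat.cast_zero, zero_mul, integral_zero]
  · have hcw : c * (reg.a k * m f / reg.Zm k) ≤ reg.mcrit k + reg.a k * m f / reg.Zm k := by
      have := hcrit k; nlinarith
    have h0 : ∀ U : GaugeConfig 4 (2 * S + 1) SU3, Multiset.countP
        (fun z : ℂ => |z.re| < c * (reg.a k * m f / reg.Zm k)) (spinorLift gammaFive *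
          wilsonDirac (fundamentalRep (Fin 3)) U (reg.mcrit k + reg.a k * m f / reg.Zm k)
            1).charpoly.roots = 0 :=
      fun U => countP_coercivityDefect_eq_zero U hcw
    simp only [h0, Nat.cast_zero, zero_mul, integral_zero, zero_div]
    positivity

/-- **The hard stub collapses to TIGHT on the free side.**  If for `N_f = 2` and `N_f = 3` some
regularisation whose line never enters the hole (`m_crit(k) ≥ 0`) is mass-scaling, asymptotically
scaling and satisfies the TIGHT clause above a threshold `M₀ ≥ 0` (the junk line `TightOnFreeSide` of
`Cruxes/TipPricing/Disproof.lean` §6, obtainable by volume padding as typed), then `LifshitzTight` holds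
with `c = 1` — and neither `TipNoBinding` nor `WegnerEstimate` is used. -/
theorem lifshitzTight_of_freeSideTight
    (h : ∀ Nf : ℕ, (Nf = 2 ∨ Nf = 3) → ∃ reg : QCDRegularisation Nf, (∀ k, 0 ≤ reg.mcrit k) ∧
      reg.HasMassScaling ∧ (reg.scheme 0 0 0).HasAsymptoticScaling ∧ ∃ M₀ : ℝ, 0 ≤ M₀ ∧
        ∀ m : Fin Nf → ℝ, (∀ f, M₀ < m f) → Tight Nf reg M₀ m) :
    LifshitzTight := by
  intro _ _ Nf hNf
  obtain ⟨reg, hcrit, h1, h2, M₀, hM₀, hT⟩ := h Nf hNf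
  exact ⟨reg, h1, h2, M₀, hM₀, 1, one_pos, fun m hm =>
    ⟨heavySideDOS_of_mcrit_nonneg reg hcrit le_rfl m fun f => lt_of_le_of_lt hM₀ (hm f), hT m hm⟩⟩

/-- **Every witness of the hard stub is pinned from above.**  If `(reg, M₀, c)` realises the body of
`LifshitzTight` at some mass tuple `m` (only its TIGHT half is used), then for every probe `M > M₀`,
eventually `m_crit(k) ≤ a_k M/Z_m(k)` (landed `mcrit_le_window_of_tight`: at positive bare mass the index
is `0` for every field).  With `a_k/Z_m(k) → 0` under mass scaling this is `limsup m_crit ≤ 0`: the stub's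
line, like the crux's, lives in the strip `(-8, o(1)]`, and the free-side witnesses of
`lifshitzTight_of_freeSideTight` sit exactly on its upper rim `0 ≤ m_crit(k) ≤ a_k M₀⁺/Z_m(k)`. -/
theorem mcrit_le_window_of_heavySideDOS_and_tight {Nf : ℕ} {reg : QCDRegularisation Nf} {M₀ c : ℝ}
    {m : Fin Nf → ℝ} (h : HeavySideDOS Nf reg c m ∧ Tight Nf reg M₀ m) (M : ℝ) (hM : M₀ < M) :
    ∀ᶠ k : ℕ in Filter.atTop, reg.mcrit k ≤ reg.a k * M / reg.Zm k :=
  Summit.QuantumFields.QCD.Theorems.TipPricing.Negative.mcrit_le_window_of_tight reg M₀ m h.2 M hM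

end Summit.QuantumFields.QCD.Theorems.TipPricing.Negative.HeavySideDOSFreeSide
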